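import Summits.QuantumFields.YangMills.Theorems.LuscherReductionRunningReductionTraceFormulaKernel
import Summits.QuantumFields.YangMills.Theorems.FemtoTransferGapEigenbasis
import Literature.Analysis.OperatorTheory.PositiveKernelSpectralTrace
import Literature.Analysis.OperatorTheory.JointEigenbasis
import HarnessLib

/-!
# Crux RED `RunningReduction`, line «KTR» rev 6: **the TRACE FORMULA `Σ_k λ_k(L,β)^T = Z_phys(L, β, T)` (`β ≥ 1`, `T ≥ 2`)** — the body of
# `TT.TraceFormula` ∕ registered stub `TT.stub_traceFormula` of `stmt-QuantumFields-19978`, proved over the re-homed objects (3/3)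

Fleet-service module of seat ym-infvol-p1 g3 (route `LuscherReduction`, crux RED `stmt-QuantumFields-19978`; route owner ym-beyond-p1 g18 PROGRESS 3 ask (δ)
«an idle M-seat on the TT door takes `stub_traceFormula` (Mercer∕HS trace of the gauge-averaged physical heat kernel = Σ λ_k^T, T ≥ 2)», ym-beyond bus
2026-08-27T06:21:40Z).  **Main theorem `traceFormula_all`** — character for character the body of `TT.TraceFormula` of the skeleton
`Cruxes/RunningReduction/Lines/ktr.lean` rev 6 (002f86ce3585fcf4) with `physTrace` the re-homed tree object (p507042), so the skeleton's stub is discharged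
by `theorem stub_traceFormula : Stmt.stub_traceFormula := Theorems.FemtoTransferGap.TT.traceFormula_all` once `TT.TraceFormula` is re-pointed:
`∀ (L : ℕ) [NeZero L] (β : ℝ) (T : ℕ), 1 ≤ β → 2 ≤ T → HasSum (fun k : ℕ => levelValue su2Rep L β k ^ T) (physTrace L β T)`.

Proof (no Mercer theorem, no trace class):
* §7 **`exists_eigenseq_levelValue`**: seat ym-infvol-p2's COMPLETE physical eigenbasis (`FemtoTransferGap.exists_isPhys_eigenseq`, p508289 — Lit
  `exists_orthonormal_eigenseq`, the min–max identification with `levelValue su2Rep L β k` for EVERY `k` over the dense physical core, completeness modulo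
  the kernel) read at the `L²` level: an orthonormal sequence `e_k` in `physL2 L` with `A e_k = λ_k e_k` and `A = 0` on `physL2 ⊖ span e`;
* §8 **`hasSum_levelValue_pow_physTraceSucc`**: Lit `hasSum_pow_integral_iterate_diag` for the symmetric bounded kernel `K_β^P` with the Hilbert basis of
  `L²(configMeasure)` «`e_k` ⊕ any Hilbert basis of `(closure span e)ᗮ`» — an eigenbasis of the operator of `K_β^P` with eigenvalues `levelValue k` resp.
  `0` (file 2/3 §6: that operator is `A` on `physL2` and `0` on `physL2ᗮ`; §7: `A = 0` on `physL2 ⊖ span e`) — together with the closed-chain identity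
  `physTraceSucc_eq_integral_iterate` (file 2/3 §5); only the `ℕ`-part of the index contributes.

HONEST FRAMING: fixed-lattice spectral theory (Reed–Simon I Thm. VI.16, VI.22–23; IV Thm. XIII.1–2) for the femto rung R2b1 of a CONDITIONAL ladder; proves
nothing of the RG content (`TwistedTraceScaling`), nothing about infinite volume, the continuum limit, a mass gap or Clay.
References: [cite: ReedSimonI1980, Thm. VI.16]; [cite: ReedSimonIV1978, Thm. XIII.1–2]; [cite: MontvayMunster1994, (3.145)]; [cite: Luscher1983, §2].
-/

set_option autoImplicit false

noncomputable section

open MeasureTheory Filter Topology Real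
open Literature.MathematicalPhysics.QuantumFieldTheory
open Literature.MathematicalPhysics.QuantumLattice
open Literature.Analysis.OperatorTheory.YMMatrixModel
open Literature.Analysis.OperatorTheory
open scoped InnerProductSpace BigOperators

namespace Summit.QuantumFields.YangMills.Theorems.FemtoTransferGap.TT

open Summit.QuantumFields.YangMills.Theorems.FemtoTransferGap
open Summit.QuantumFields.YangMills.Theorems.FemtoTransferGap.PhysL2

variable {L : ℕ} [NeZero L]

/-! ## §7 The complete physical eigen-sequence (seat ym-infvol-p2's `exists_isPhys_eigenseq`, p508289), read at the `L²` level -/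

/-- **The physical eigen-sequence at the `L²` level.**  For `β > 0`: an orthonormal sequence `e_k` in the physical closed subspace of exact
eigenvectors of the `L²` transfer operator `A` of `K_β`, with eigenvalues EQUAL TO the min–max values `levelValue su2Rep L β k` (non-negative), such
that `A` KILLS every physical class orthogonal to all `e_k`.  This is seat ym-infvol-p2's complete physical eigenbasis
`FemtoTransferGap.exists_isPhys_eigenseq` (p508289: Lit `exists_orthonormal_eigenseq` + identification over the dense core + completeness modulo the
kernel), transported to classes by `toL2` ∕ `apply_toL2`. [cite: ReedSimonI1980, Thm. VI.16] [cite: ReedSimonIV1978, Thm. XIII.1–2] -/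
theorem exists_eigenseq_levelValue {β : ℝ} (hβ : 0 < β) {A : Lp ℝ 2 (configMeasure SU2 L) →L[ℝ] Lp ℝ 2 (configMeasure SU2 L)}
    (hA : ∀ v : Lp ℝ 2 (configMeasure SU2 L),
      (A v : GaugeConfig 3 L SU2 → ℝ) =ᵐ[configMeasure SU2 L] fun U => ∫ V, transferKernel su2Rep β U V * v V ∂configMeasure SU2 L) :
    ∃ (e : ℕ → physL2 L) (ev : ℕ → ℝ), Orthonormal ℝ e ∧
      (∀ k, A (e k : Lp ℝ 2 (configMeasure SU2 L)) = ev k • (e k : Lp ℝ 2 (configMeasure SU2 L))) ∧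
      (∀ k, 0 ≤ ev k) ∧ (∀ k, ev k = levelValue su2Rep L β k) ∧
      ∀ x : physL2 L, (∀ i, ⟪e i, x⟫_ℝ = 0) → A (x : Lp ℝ 2 (configMeasure SU2 L)) = 0 := by
  obtain ⟨e, hon, heig, -, hker⟩ := exists_isPhys_eigenseq (L := L) hβ
  refine ⟨fun k => toV (e k), fun k => levelValue su2Rep L β k, ?_, fun k => ?_, fun k => (levelValue_su2Rep_pos hβ k).le,
    fun _ => rfl, fun x hx => ?_⟩
  · -- orthonormality of the classes
    rw [orthonormal_iff_ite]
    intro i l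
    rw [Submodule.coe_inner, coe_toV, coe_toV, inner_toL2]
    exact hon i l
  · -- the eigen-equation at the `L²` level
    have h1 : transferOp β (e k) = levelValue su2Rep L β k • e k := Subtype.ext (by rw [coe_transferOp, heig k]; rfl)
    rw [coe_toV, apply_toL2 hA, h1, map_smul]
  · -- completeness modulo the kernel
    have hx' : ∀ k, ⟪toL2 (e k), (x : Lp ℝ 2 (configMeasure SU2 L))⟫_ℝ = 0 := fun k => by
      have h := hx k
      rwa [Submodule.coe_inner, coe_toV] at h
    have h0 := hker (x : Lp ℝ 2 (configMeasure SU2 L)) x.2 hx'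
    apply Lp.ext
    filter_upwards [hA (x : Lp ℝ 2 (configMeasure SU2 L)), Lp.coeFn_zero ℝ 2 (configMeasure SU2 L)] with U h1 h2
    rw [h1, h2, Pi.zero_apply, h0 U]

/-! ## §8 The trace formula -/

set_option maxHeartbeats 800000 in
/-- **Trace formula, successor form**: `Σ_k λ_k^{M+2} = Z_phys(L, β, M+2)` for `β > 0`.  The Hilbert basis of `L²(configMeasure)` used in Lit
`hasSum_pow_integral_iterate_diag` for the kernel `K_β^P` is «the physical eigen-sequence `e_k` (eigenvalues `levelValue k`) ⊕ any Hilbert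
basis of the orthogonal complement of its closed span (eigenvalue `0`: there `K_β^P`'s operator vanishes — on `physL2ᗮ` because the sections of
`K_β^P` are physical, on `physL2 ⊖ span e` by domination)». [cite: ReedSimonI1980, Thm. VI.22–VI.23] [cite: MontvayMunster1994, (3.145)] -/
theorem hasSum_levelValue_pow_physTraceSucc {β : ℝ} (hβ : 0 < β) (M : ℕ) :
    HasSum (fun k : ℕ => levelValue su2Rep L β k ^ (M + 2)) (physTraceSucc L β (M + 1)) := by
  classical
  haveI : SecondCountableTopology SU2 := secondCountableTopology_su2
  haveI : Fact ((2 : ENNReal) ≠ ⊤) := ⟨ENNReal.ofNat_ne_top⟩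
  haveI : CompleteSpace (physL2 L) := isClosed_physL2.completeSpace_coe
  obtain ⟨M0, -, hM0⟩ := exists_abs_transferKernel_le (L := L) β
  -- the two `L²` operators
  obtain ⟨A, hA, hsa, hc⟩ := exists_transferOpL2 (L := L) β
  have hKP := stronglyMeasurable_physKernel (L := L) β
  have hCP : ∀ U V : GaugeConfig 3 L SU2, ‖physKernel β U V‖ ≤ M0 := fun U V => by
    rw [Real.norm_eq_abs]; exact abs_physKernel_le hM0 U V
  obtain ⟨AP, hAP⟩ := exists_kernelOp (μ := configMeasure SU2 L) hKP hCP
  -- the physical eigen-sequence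
  obtain ⟨e, ev, hon, hAe, hev0, hev, hker⟩ := exists_eigenseq_levelValue (L := L) hβ hA
  set u : ℕ → Lp ℝ 2 (configMeasure SU2 L) := fun n => (e n : Lp ℝ 2 (configMeasure SU2 L)) with hu
  set E : Submodule ℝ (Lp ℝ 2 (configMeasure SU2 L)) := (Submodule.span ℝ (Set.range u)).topologicalClosure with hE
  have hu_on : Orthonormal ℝ u := (physL2 L).subtypeₗᵢ.orthonormal_comp_iff.mpr hon
  have hu_mem : ∀ n, u n ∈ E := fun n => Submodule.le_topologicalClosure _ (Submodule.subset_span (Set.mem_range_self n))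
  -- a Hilbert basis of the orthogonal complement of the closed span of the eigen-sequence
  obtain ⟨w, c, hwc⟩ := exists_hilbertBasis ℝ (↥Eᗮ)
  have hc_on' : Orthonormal ℝ ((↑) : w → ↥Eᗮ) := hwc ▸ c.orthonormal
  haveI : Countable w := (hc_on'.countable_of_separableSpace (𝕜 := ℝ)).to_subtype
  have hc_on : Orthonormal ℝ (fun j : w => (((j : ↥Eᗮ)) : Lp ℝ 2 (configMeasure SU2 L))) :=
    Eᗮ.subtypeₗᵢ.orthonormal_comp_iff.mpr hc_on'
  -- the combined family
  set v : ℕ ⊕ w → Lp ℝ 2 (configMeasure SU2 L) := Sum.elim u (fun j : w => ((j : ↥Eᗮ) : Lp ℝ 2 (configMeasure SU2 L))) with hvdef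
  have hv : Orthonormal ℝ v := by
    rw [orthonormal_iff_ite]
    rintro (n | j) (n' | j')
    · simp only [hvdef, Sum.elim_inl, Sum.inl.injEq]
      exact (orthonormal_iff_ite.mp hu_on) n n'
    · simp only [hvdef, Sum.elim_inl, Sum.elim_inr, reduceCtorEq, if_false]
      exact Submodule.inner_right_of_mem_orthogonal (hu_mem n) (j' : ↥Eᗮ).2
    · simp only [hvdef, Sum.elim_inl, Sum.elim_inr, reduceCtorEq, if_false]
      exact Submodule.inner_left_of_mem_orthogonal (hu_mem n') (j : ↥Eᗮ).2
    · simp only [hvdef, Sum.elim_inr, Sum.inr.injEq]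
      exact (orthonormal_iff_ite.mp hc_on) j j'
  -- completeness
  have hrange : Set.range u ⊆ Set.range v := by
    rintro _ ⟨n, rfl⟩; exact ⟨Sum.inl n, rfl⟩
  have hspan : (Submodule.span ℝ (Set.range v))ᗮ = ⊥ := by
    rw [Submodule.eq_bot_iff]
    intro y hy
    have hyv : ∀ i, ⟪v i, y⟫_ℝ = 0 := fun i =>
      Submodule.inner_right_of_mem_orthogonal (Submodule.subset_span (Set.mem_range_self i)) hy
    have hyE : y ∈ Eᗮ := by
      rw [Submodule.mem_orthogonal]
      intro z hz
      have hS : IsClosed {z : Lp ℝ 2 (configMeasure SU2 L) | ⟪z, y⟫_ℝ = 0} :=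
        isClosed_eq (continuous_id.inner continuous_const) continuous_const
      have hsub : ((Submodule.span ℝ (Set.range u) : Submodule ℝ (Lp ℝ 2 (configMeasure SU2 L))) :
          Set (Lp ℝ 2 (configMeasure SU2 L))) ⊆ {z | ⟪z, y⟫_ℝ = 0} := fun z hz =>
        Submodule.inner_right_of_mem_orthogonal (Submodule.span_mono hrange hz) hy
      have hz' : z ∈ closure ((Submodule.span ℝ (Set.range u) : Submodule ℝ (Lp ℝ 2 (configMeasure SU2 L))) :
          Set (Lp ℝ 2 (configMeasure SU2 L))) := by
        rw [← Submodule.topologicalClosure_coe]; exact hz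
      exact closure_minimal hsub hS hz'
    set y' : ↥Eᗮ := ⟨y, hyE⟩ with hy'
    have hc0 : ∀ j : w, ⟪c j, y'⟫_ℝ = 0 := fun j => by
      rw [show c j = (j : ↥Eᗮ) from congrFun hwc j, Submodule.coe_inner]
      exact hyv (Sum.inr j)
    have hrepr : c.repr y' = 0 := by
      ext j
      rw [c.repr_apply_apply, hc0 j]
      rfl
    have hy'0 : y' = 0 := by simpa using congrArg c.repr.symm hrepr
    exact congrArg Subtype.val hy'0
  set b : HilbertBasis (ℕ ⊕ w) ℝ (Lp ℝ 2 (configMeasure SU2 L)) := HilbertBasis.mkOfOrthogonalEqBot hv hspan with hbdef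
  have hb : ∀ i, b i = v i := fun i => by rw [hbdef, HilbertBasis.coe_mkOfOrthogonalEqBot]
  -- eigen-relations of the operator of `K_β^P` along `b`
  set lam : ℕ ⊕ w → ℝ := Sum.elim ev (fun _ => 0) with hlamdef
  have hbAP : ∀ i, AP (b i) = lam i • b i := by
    intro i
    rw [hb]
    rcases i with n | j
    · simp only [hvdef, hlamdef, Sum.elim_inl]
      rw [kernelOpP_apply_of_mem_physL2 hM0 hA hAP (e n).2, hAe]
    · simp only [hvdef, hlamdef, Sum.elim_inr, zero_smul]
      set y : Lp ℝ 2 (configMeasure SU2 L) := ((j : ↥Eᗮ) : Lp ℝ 2 (configMeasure SU2 L)) with hydef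
      have hyE : y ∈ Eᗮ := (j : ↥Eᗮ).2
      set y₁ : Lp ℝ 2 (configMeasure SU2 L) := (physL2 L).starProjection y with hy₁def
      have hy₁ : y₁ ∈ physL2 L := Submodule.starProjection_apply_mem _ y
      have hy₂ : y - y₁ ∈ (physL2 L)ᗮ := Submodule.sub_starProjection_mem_orthogonal y
      have h1 : AP (y - y₁) = 0 := kernelOpP_apply_of_mem_orthogonal hM0 hAP hy₂
      have h2 : AP y₁ = A y₁ := kernelOpP_apply_of_mem_physL2 hM0 hA hAP hy₁
      have h3 : A y₁ = 0 := by
        refine hker ⟨y₁, hy₁⟩ fun i => ?_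
        rw [Submodule.coe_inner]
        have ha : ⟪(e i : Lp ℝ 2 (configMeasure SU2 L)), y⟫_ℝ = 0 := Submodule.inner_right_of_mem_orthogonal (hu_mem i) hyE
        have hb' : ⟪(e i : Lp ℝ 2 (configMeasure SU2 L)), y - y₁⟫_ℝ = 0 := Submodule.inner_right_of_mem_orthogonal (e i).2 hy₂
        have hsplit : ⟪(e i : Lp ℝ 2 (configMeasure SU2 L)), y₁⟫_ℝ =
            ⟪(e i : Lp ℝ 2 (configMeasure SU2 L)), y⟫_ℝ - ⟪(e i : Lp ℝ 2 (configMeasure SU2 L)), y - y₁⟫_ℝ := by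
          rw [← inner_sub_right, sub_sub_cancel]
        show ⟪(e i : Lp ℝ 2 (configMeasure SU2 L)), y₁⟫_ℝ = 0
        rw [hsplit, ha, hb', sub_zero]
      calc AP y = AP (y₁ + (y - y₁)) := by rw [add_sub_cancel]
        _ = AP y₁ + AP (y - y₁) := map_add _ _ _
        _ = 0 := by rw [h1, h2, h3, add_zero]
  have hlam0 : ∀ i, 0 ≤ lam i := by
    rintro (n | j)
    · simp only [hlamdef, Sum.elim_inl]; exact hev0 n
    · simp only [hlamdef, Sum.elim_inr]; exact le_rfl
  -- the spectral trace formula for `K_β^P`, and the cyclic identity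
  have hmain := hasSum_pow_integral_iterate_diag (μ := configMeasure SU2 L) (b := b) hKP hCP (physKernel_symm β) hAP hbAP hlam0 M
  rw [← physTraceSucc_eq_integral_iterate hM0 M] at hmain
  -- only the `ℕ`-part contributes
  have hsumm : Summable (fun i : ℕ ⊕ w => lam i ^ (M + 2)) := hmain.summable
  have hinl : HasSum (fun n : ℕ => lam (Sum.inl n) ^ (M + 2)) (∑' n : ℕ, lam (Sum.inl n) ^ (M + 2)) :=
    (hsumm.comp_injective Sum.inl_injective).hasSum
  have hinr : HasSum (fun j : w => lam (Sum.inr j) ^ (M + 2)) 0 := by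
    have : (fun j : w => lam (Sum.inr j) ^ (M + 2)) = fun _ => 0 := by
      funext j; simp [hlamdef]
    rw [this]; exact hasSum_zero
  have htot : HasSum (fun i : ℕ ⊕ w => lam i ^ (M + 2)) ((∑' n : ℕ, lam (Sum.inl n) ^ (M + 2)) + 0) := HasSum.sum hinl hinr
  have heq : physTraceSucc L β (M + 1) = ∑' n : ℕ, lam (Sum.inl n) ^ (M + 2) := by
    have h := hmain.unique htot; rw [add_zero] at h; exact h
  have hfun : (fun n : ℕ => lam (Sum.inl n) ^ (M + 2)) = fun k : ℕ => levelValue su2Rep L β k ^ (M + 2) := by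
    funext n; simp only [hlamdef, Sum.elim_inl, hev n]
  rw [heq, ← hfun]
  exact hinl

/-- **TRACE FORMULA** (body of `TT.TraceFormula` of the «KTR» rev-6 skeleton, verbatim over the re-homed objects): for `β ≥ 1` and `T ≥ 2`,
`Σ_k λ_k(L,β)^T = Z_phys(L, β, T)` — the zero-flux min–max transfer values are the eigenvalues with multiplicity of the Hilbert–Schmidt
compression `P K_β P`, and the trace of its `T`-th power is the closed kernel chain with one physical average. [cite: ReedSimonI1980, Thm. VI.22–VI.23]
[cite: ReedSimonIV1978, Thm. XIII.1] [cite: MontvayMunster1994, (3.145)] -/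
theorem traceFormula (L : ℕ) [NeZero L] (β : ℝ) (T : ℕ) (hβ : 1 ≤ β) (hT : 2 ≤ T) :
    HasSum (fun k : ℕ => levelValue su2Rep L β k ^ T) (physTrace L β T) := by
  obtain ⟨M, rfl⟩ : ∃ M, T = M + 2 := ⟨T - 2, by omega⟩
  exact hasSum_levelValue_pow_physTraceSucc (L := L) (zero_lt_one.trans_le hβ) M

/-- **TRACE FORMULA, closed form** (= the text of `TT.TraceFormula`, so that the skeleton's `stub_traceFormula` is `traceFormula_all`).
[cite: ReedSimonIV1978, Thm. XIII.1] [cite: MontvayMunster1994, (3.145)] -/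
theorem traceFormula_all : ∀ (L : ℕ) [NeZero L] (β : ℝ) (T : ℕ), 1 ≤ β → 2 ≤ T →
    HasSum (fun k : ℕ => levelValue su2Rep L β k ^ T) (physTrace L β T) :=
  fun L _ β T hβ hT => traceFormula L β T hβ hT

end Summit.QuantumFields.YangMills.Theorems.FemtoTransferGap.TT

end
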